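import Summits.QuantumFields.YangMills.Theorems.BalabanUVNodesPortS1SmallSu2
import Summits.QuantumFields.YangMills.Theorems.BalabanUVNodesN07CentralResponseOnto

/-!
# NODE O port PT-A — THE LETTER `RecordB0BlockInvertible V^{(k)}` HOLDS AT EVERY SMALL BACKGROUND: if every (0.4) loop variable of `V^{(k)}` is within `α` of `1` (`α ≤ 1∕24`,
# `157·α < L^{1−d}`) — e.g. every plaquette variable within `t` of `1`, `((d+2)L)²t∕4 =: α` — then the `b₀`-block `A₁` of `LQ̃(V^{(k)})` is invertible (print's «h is uniquely defined»,
# [I] p.267, OFF the base point); on the way: `Q̃(V^{(k)}, ·)` is `C^∞` at `B′ = 0` there, so DEF-1's (2.11) carrier `recordLQt Vk := fderiv (recordQt Vk) 0` is NOT junk, and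
# `LQ̃(Vk) x (c) = D(W ↦ avgM W c)(↑Vk)[B′·↑Vk] · ↑Ū(c)*` — the response of the (0.4) average (dag-n07-w2's lane) times `Ū(c)*`

Cell `ym-nodeO-ideate`, porter seat `ymgap-nodeO-port-PTA-1` (gen 5); `--supports stmt-QuantumFields-27930` (helper; PORT-PLAN-v4 §6 «the letter at every small background», the porter-sized
brick (γ) of CRIT-1's LOCATED-B reading — NOT P0).  [I] = [Balaban1987RG1], [B7] = [Balaban1985Averaging], [15] = [Balaban1985Variational].
CONSUMED BY NAME, nothing modified: DEF-1's `recordQt ∕ recordLQt ∕ recordLQtMat ∕ recordLQtB0 ∕ RecordB0BlockInvertible ∕ pert ∕ fluctMat ∕ su2Gen ∕ su2Coord` (`…K0RecordFormatNamesFluct∕FluctD`);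
this lineage's `det_recordLQtB0_eq_prod` (✓p809706), `recordLQtMat_mulVec` (✓p807984), `eq_zero_of_mem_lieSU_of_su2Coord` (✓p810910), `pert_zero ∕ fluctMat_smul ∕ star_su2Gen ∕ trace_su2Gen ∕
exp_fluctMat_mem` (✓p810401); the dag-n07-w2 lane: `N07AveragingLocalSmooth.contDiffAt_coe_avgFun_comp_apply_of_small_of_local` (one-bond `C^n` brick), `N07CentralDescendantLifts.
hasDerivAt_coe_avgFun_comp_apply_of_small_of_local` (one-bond velocity brick), ★ `N07CentralResponseOnto.centralResponse_onto_sharp` (the response in the private coordinate `b₀(c)` is ONTO);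
`Node00.AveragingSmooth` (`avgM`, `coeField`); `LatticeWordStokes.dist1_loopHol_le`; `MatrixLog.analyticAt_mlog`, `B7TransferAnalyticMean.hasFDerivAt_mlog_one`.

THE ARGUMENT.  `Q̃(Vk, x)(c) = mlog(↑Ū(V′V^{(k)})(c)·↑Ū(V^{(k)})(c)*)` (`recordQt_apply_eq_mlog`); the chart `x ↦ ↑(V′V^{(k)})(b) = exp(B′(b))·↑Vk(b)` is `C^∞` with velocity `B′(b)·↑Vk(b)` along lines
(§1); under the guard at every coarse bond the (0.4) average is `C^∞` along the chart (N07's brick), the argument of `mlog` is `1` at `B′ = 0` and `mlog` is analytic at `1` ⇒ `Q̃(Vk, ·)` is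
`C^∞` at `0` (★★ `contDiffAt_recordQt_of_small`, `hasFDerivAt_recordQt_of_small`), and comparing the two velocities of `s ↦ Q̃(Vk, s·x)(c)` (`mlog′(1) = id`) gives ★★
`recordLQt_apply_eq_fderiv_avgM`.  For the letter (§4): the `c`-block of `A₁` applied to colour coefficients `v` is `su2Coord` of `LQ̃(Vk)` on the coordinate vector supported on `b₀(c)`
(`b0Block_mulVec`); given a target `w`, `M_w = Σ w_j su2Gen j ∈ 𝔰𝔲(2)`, the onto response supplies `Y ∈ 𝔰𝔲(2)` with `D(avgM · c)[u_β·Y·δ_β] = Ū·(Ū*M_wŪ)`; the direction `X = u_βYu_β*`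
on `b₀(c)` has velocity `u_β·Y·δ_β`, so `LQ̃(Vk) e_X (c) = Ū Ū* M_w Ū Ū* = M_w` and the block hits `w` — every `3 × 3` block is onto, hence nonsingular, and `det A₁ = ∏_c det A₁(c) ≠ 0`
(★★★ `recordB0BlockInvertible_of_loopSmall`; plaquette currency ★★★ `recordB0BlockInvertible_of_plaqSmall`).
* §1 `coe_pert`, `contDiff_fluctMat`, `contDiff_coe_pert_apply`, `hasDerivAt_coe_pert_line`.
* §2 `recordQt_apply_eq_mlog`, ★★ `contDiffAt_recordQt_of_small`, ★★ `hasFDerivAt_recordQt_of_small`, ★★ `recordLQt_apply_eq_fderiv_avgM`.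
* §3 `sum_smul_su2Gen_mem_lieSU`, `su2Coord_sum_smul_su2Gen`, `sum_su2Coord_smul_su2Gen`, `fluctMat_bondVec`.
* §4 `b0Block_mulVec`, ★★★ `recordB0BlockInvertible_of_loopSmall`, ★★★ `recordB0BlockInvertible_of_plaqSmall`.

WHAT THIS BUYS FOR THE LINE (27930 skeleton `pta_residueW`, `stub_LZ`).  The Z-bridge and the two-bracket ∕ (61)–(63) form of `phiLZ` (✓p807984, ✓p809947, ✓p810202, ✓p811152) display two
letters at a small background: `RecordB0BlockInvertible Vk` and `PosDef (recordPreckLoc …)`.  The first is now a THEOREM at every background in the (0.4) small-field regime (not only at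
`Vk = 1`, ✓p810869); the displayed list of the LZ (63)-algebra off the base point is exactly (β) positivity ∕ (E2) — plus P0's (α) (holomorphic carriers), per №509.
HONEST FRAMING.  Kernel calculus ∕ linear algebra over the tree's own theorems; NOTHING of Bałaban's estimates asserted, ported or discharged; `stub_LZ` remains BLOCKED-ON P0 (α)+(β),
`stub_FE` XXL; 27930 OPEN · no claim; K0⁷∕K-Ax OPEN; NODE O 0∕1; COUNT 8∕28 · K 1∕4 UNMOVED; finite `𝕋⁴_{L^K}` at fixed ε — NOT continuum ∕ OS ∕ Clay; **the Yang–Mills mass gap is NOT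
proved by any of this.**  No `sorry`, no `def`, no `instance`, no `notation`; standard axioms.
-/

noncomputable section

open scoped BigOperators Matrix.Norms.L2Operator Topology

namespace Summit.QuantumFields.YangMills.Theorems.BalabanUVNodesPortS1

open Summit.QuantumFields.YangMills.Theorems.K0RecordFormatNames
open Summit.QuantumFields.YangMills.BalabanUVNodes
open Literature.MathematicalPhysics.QuantumFieldTheory.Balaban1983to89
open Literature.MathematicalPhysics.QuantumFieldTheory.Balaban1983to89.Node00
open Literature.MathematicalPhysics.QuantumFieldTheory.Balaban1983to89.T4Continuum (T4Family)
open Literature.MathematicalPhysics.QuantumFieldTheory.Balaban1983to89.BlockAveraging (avgFun loopHol Small Idx)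
open Literature.MathematicalPhysics.QuantumFieldTheory.Balaban1983to89.BlockAveragingHaarAC (centralBond IsCentral)
open Literature.MathematicalPhysics.QuantumFieldTheory.Balaban1983to89.ExpMeanLog (expMeanLogSU deltaSU)
open Literature.MathematicalPhysics.QuantumFieldTheory.Balaban1983to89.T4AdjointCovarianceUnitary (lieSU mem_lieSU_iff conj_mem_lieSU)
open NormedSpace (exp)
open _root_.Matrix _root_.Filter

variable (F : T4Family)

/-! ## §1  The chart `x ↦ V′V^{(k)}` bond by bond: smooth, with velocity `B′(b)·V^{(k)}(b)` -/

/-- `↑(pert Vk x b) = exp(fluctMat x b) · ↑Vk(b)`. [cite: Balaban1987RG1, (2.4) p.266 (bookkeeping)] -/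
theorem coe_pert (k K : ℕ) (Vk : GaugeField (F.P K) k (SU 2)) (x : FluctIdx F k K → ℝ) (b : PBond (F.P K) k) :
    ((pert F k K Vk x b : SU 2) : MatA 2) = exp (fluctMat F k K x b) * ((Vk b : SU 2) : MatA 2) := by
  rw [pert, suOfMat_of_mem (exp_fluctMat_mem F k K x b)]
  rfl

/-- `x ↦ fluctMat x b` is `C^∞` (it is linear). [folklore] -/
theorem contDiff_fluctMat (k K : ℕ) (b : PBond (F.P K) k) : ContDiff ℝ ⊤ (fun x : FluctIdx F k K → ℝ => fluctMat F k K x b) := by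
  show ContDiff ℝ ⊤ fun x : FluctIdx F k K → ℝ => ∑ a, ((x (b, a) : ℝ) : ℂ) • su2Gen a
  exact ContDiff.sum fun a _ => (Complex.ofRealCLM.contDiff.comp (contDiff_apply ℝ ℝ (b, a))).smul contDiff_const

/-- **The chart is `C^∞` bond by bond**: `x ↦ ↑(V′V^{(k)})(b) = exp(B′(b))·↑V^{(k)}(b)`. [cite: Balaban1987RG1, (2.4) p.266 (bookkeeping)] -/
theorem contDiff_coe_pert_apply (k K : ℕ) (Vk : GaugeField (F.P K) k (SU 2)) (b : PBond (F.P K) k) :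
    ContDiff ℝ ⊤ (fun x : FluctIdx F k K → ℝ => ((pert F k K Vk x b : SU 2) : MatA 2)) := by
  have hexp : ContDiff ℝ ⊤ (exp : MatA 2 → MatA 2) :=
    contDiff_iff_contDiffAt.2 fun X => ((NormedSpace.exp_analytic (𝕂 := ℂ) X).contDiffAt).restrict_scalars ℝ
  have hfun : (fun x : FluctIdx F k K → ℝ => ((pert F k K Vk x b : SU 2) : MatA 2)) =
      fun x => exp (fluctMat F k K x b) * ((Vk b : SU 2) : MatA 2) := funext fun x => coe_pert F k K Vk x b
  rw [hfun]
  exact (hexp.comp (contDiff_fluctMat F k K b)).mul contDiff_const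

/-- **The bond velocities of the chart line `s ↦ V′_sV^{(k)}`, `B′_s = s·B′`**: `B′(b)·↑V^{(k)}(b)` at `s = 0`. [cite: Balaban1987RG1, (2.4) p.266 (bookkeeping)] -/
theorem hasDerivAt_coe_pert_line (k K : ℕ) (Vk : GaugeField (F.P K) k (SU 2)) (x : FluctIdx F k K → ℝ) (b : PBond (F.P K) k) :
    HasDerivAt (fun s : ℝ => ((pert F k K Vk (s • x) b : SU 2) : MatA 2)) (fluctMat F k K x b * ((Vk b : SU 2) : MatA 2)) 0 := by
  have hfun : (fun s : ℝ => ((pert F k K Vk (s • x) b : SU 2) : MatA 2)) =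
      fun s => exp (s • fluctMat F k K x b) * ((Vk b : SU 2) : MatA 2) := by
    funext s
    rw [coe_pert, fluctMat_smul]
  rw [hfun]
  have hline : HasDerivAt (fun s : ℝ => s • fluctMat F k K x b) (fluctMat F k K x b) 0 := by
    simpa using (hasDerivAt_id (0 : ℝ)).smul_const (fluctMat F k K x b)
  have hexp : HasFDerivAt (exp : MatA 2 → MatA 2) ((1 : MatA 2 →L[ℂ] MatA 2).restrictScalars ℝ) ((fun s : ℝ => s • fluctMat F k K x b) 0) := by
    have e : (fun s : ℝ => s • fluctMat F k K x b) 0 = 0 := zero_smul _ _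
    rw [e]
    exact (hasFDerivAt_exp_zero (𝕂 := ℂ)).restrictScalars ℝ
  have hcomp := hexp.comp_hasDerivAt (0 : ℝ) hline
  have hval : ((1 : MatA 2 →L[ℂ] MatA 2).restrictScalars ℝ) (fluctMat F k K x b) = fluctMat F k K x b := rfl
  rw [hval] at hcomp
  exact hcomp.mul_const _

/-! ## §2  `Q̃(V^{(k)}, ·)` is `C^∞` at `0` at every small background; `LQ̃` is the response of the (0.4) average times `Ū(c)*` -/

/-- `Q̃(Vk, x)(c) = mlog(↑Ū(V′V^{(k)})(c) · ↑Ū(V^{(k)})(c)*)` (the `SU(2)` inverse is the adjoint). [cite: Balaban1987RG1, p.267 (bookkeeping)] -/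
theorem recordQt_apply_eq_mlog (k K : ℕ) (Vk : GaugeField (F.P K) k (SU 2)) (x : FluctIdx F k K → ℝ) (c : PBond (F.P K) (k + 1)) :
    recordQt F k K Vk x c = MatrixLog.mlog (((avgFun expMeanLogSU (pert F k K Vk x) c : SU 2) : MatA 2) * star (((avgFun expMeanLogSU Vk c : SU 2) : MatA 2))) := by
  rw [recordQt, avOfRecord_avg, Submonoid.coe_mul]
  rfl

/-- ★★ **`Q̃(V^{(k)}, ·)` IS `C^∞` AT `B′ = 0` AT EVERY SMALL BACKGROUND** (all (0.4) loop variables of `Vk` in the guard at every coarse bond, standing range): the (0.4) average is `C^∞`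
along the chart by N07's one-bond brick, `Ū(V′V^{(k)})(c)·Ū(V^{(k)})(c)*` is `1` at `B′ = 0`, and the series logarithm is analytic at `1`. [cite: Balaban1987RG1, p.267 («L is a linear transformation»), (0.4) p.253] -/
theorem contDiffAt_recordQt_of_small (k K : ℕ) (hk : k + 1 ≤ (F.P K).m + (F.P K).K) (Vk : GaugeField (F.P K) k (SU 2))
    (hsmall : ∀ c : PBond (F.P K) (k + 1), Small expMeanLogSU Vk c) : ContDiffAt ℝ ⊤ (recordQt F k K Vk) 0 := by
  refine contDiffAt_pi.2 fun c => ?_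
  have h0 : pert F k K Vk 0 = Vk := pert_zero F k K Vk
  have havg : ContDiffAt ℝ ⊤ (fun x : FluctIdx F k K → ℝ => ((avgFun expMeanLogSU (pert F k K Vk x) c : SU 2) : MatA 2)) 0 :=
    N07AveragingLocalSmooth.contDiffAt_coe_avgFun_comp_apply_of_small_of_local hk (Φ := pert F k K Vk) c (by rw [h0]; exact hsmall c)
      fun b _ => (contDiff_coe_pert_apply F k K Vk b).contDiffAt
  have hG : ContDiffAt ℝ ⊤ (fun x : FluctIdx F k K → ℝ =>
      ((avgFun expMeanLogSU (pert F k K Vk x) c : SU 2) : MatA 2) * star (((avgFun expMeanLogSU Vk c : SU 2) : MatA 2))) 0 := havg.mul contDiffAt_const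
  have hG0 : ((avgFun expMeanLogSU (pert F k K Vk 0) c : SU 2) : MatA 2) * star (((avgFun expMeanLogSU Vk c : SU 2) : MatA 2)) = 1 := by
    rw [h0]
    exact (Matrix.mem_unitaryGroup_iff).mp (Matrix.mem_specialUnitaryGroup_iff.mp (avgFun expMeanLogSU Vk c).2).1
  have hmlog : ContDiffAt ℝ ⊤ (MatrixLog.mlog : MatA 2 → MatA 2)
      ((fun x : FluctIdx F k K → ℝ => ((avgFun expMeanLogSU (pert F k K Vk x) c : SU 2) : MatA 2) * star (((avgFun expMeanLogSU Vk c : SU 2) : MatA 2))) 0) := by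
    have e : (fun x : FluctIdx F k K → ℝ => ((avgFun expMeanLogSU (pert F k K Vk x) c : SU 2) : MatA 2) * star (((avgFun expMeanLogSU Vk c : SU 2) : MatA 2))) 0 = 1 := hG0
    rw [e]
    exact ((MatrixLog.analyticAt_mlog (𝔄 := MatA 2) (X := 1) (by simp)).contDiffAt).restrict_scalars ℝ
  have hcomp := hmlog.comp 0 hG
  have hfun : (fun x => recordQt F k K Vk x c) = (MatrixLog.mlog : MatA 2 → MatA 2) ∘ fun x : FluctIdx F k K → ℝ =>
      ((avgFun expMeanLogSU (pert F k K Vk x) c : SU 2) : MatA 2) * star (((avgFun expMeanLogSU Vk c : SU 2) : MatA 2)) :=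
    funext fun x => recordQt_apply_eq_mlog F k K Vk x c
  rw [hfun]
  exact hcomp

/-- ★★ **`Q̃(V^{(k)}, ·)` IS DIFFERENTIABLE AT `0` AT EVERY SMALL BACKGROUND, with derivative DEF-1's `recordLQt Vk`** — the (2.11) carrier `LQ̃` is NOT junk off the base point.
[cite: Balaban1987RG1, p.267 («L is a linear transformation»), (0.4) p.253] -/
theorem hasFDerivAt_recordQt_of_small (k K : ℕ) (hk : k + 1 ≤ (F.P K).m + (F.P K).K) (Vk : GaugeField (F.P K) k (SU 2))
    (hsmall : ∀ c : PBond (F.P K) (k + 1), Small expMeanLogSU Vk c) : HasFDerivAt (recordQt F k K Vk) (recordLQt F k K Vk) 0 := by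
  have hd : DifferentiableAt ℝ (recordQt F k K Vk) 0 := (contDiffAt_recordQt_of_small F k K hk Vk hsmall).differentiableAt (by simp)
  rw [recordLQt]
  exact hd.hasFDerivAt

/-- ★★ **`LQ̃(V^{(k)})` IS THE RESPONSE OF THE (0.4) AVERAGE TIMES `Ū(c)*`**: for every direction `B′ = x`,
`(LQ̃(Vk) x)(c) = D(W ↦ avgM W c)(↑Vk)[b ↦ B′(b)·↑Vk(b)] · ↑Ū(Vk)(c)*` — both sides are the velocity at `s = 0` of `s ↦ Q̃(Vk, s·x)(c)` (`mlog′(1) = id`; N07's one-bond velocity brick).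
[cite: Balaban1987RG1, p.267, (0.4) p.253; Balaban1985Variational, (44) p.285] -/
theorem recordLQt_apply_eq_fderiv_avgM (k K : ℕ) (hk : k + 1 ≤ (F.P K).m + (F.P K).K) (Vk : GaugeField (F.P K) k (SU 2))
    (hsmall : ∀ c : PBond (F.P K) (k + 1), Small expMeanLogSU Vk c) (x : FluctIdx F k K → ℝ) (c : PBond (F.P K) (k + 1)) :
    recordLQt F k K Vk x c =
      fderiv ℝ (fun W : PBond (F.P K) k → MatA 2 => avgM W c) (coeField Vk) (fun b => fluctMat F k K x b * ((Vk b : SU 2) : MatA 2)) *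
        star (((avgFun expMeanLogSU Vk c : SU 2) : MatA 2)) := by
  -- (i) the velocity of `s ↦ Q̃(Vk, s·x)(c)` from the Fréchet derivative
  have hF := hasFDerivAt_recordQt_of_small F k K hk Vk hsmall
  have hline : HasDerivAt (fun s : ℝ => s • x) x 0 := by simpa using (hasDerivAt_id (0 : ℝ)).smul_const x
  have h1 : HasFDerivAt (recordQt F k K Vk) (recordLQt F k K Vk) ((fun s : ℝ => s • x) 0) := by
    have e : (fun s : ℝ => s • x) 0 = 0 := zero_smul _ _
    rw [e]; exact hF
  have hcomp : HasDerivAt (recordQt F k K Vk ∘ fun s : ℝ => s • x) (recordLQt F k K Vk x) 0 := h1.comp_hasDerivAt (0 : ℝ) hline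
  have hL : HasDerivAt (fun s : ℝ => recordQt F k K Vk (s • x) c) (recordLQt F k K Vk x c) 0 := (hasDerivAt_pi.mp hcomp) c
  -- (ii) the velocity through the average and the logarithm
  have h0 : pert F k K Vk ((0 : ℝ) • x) = Vk := by rw [zero_smul, pert_zero]
  have havg : HasDerivAt (fun s : ℝ => ((avgFun expMeanLogSU (pert F k K Vk (s • x)) c : SU 2) : MatA 2))
      (fderiv ℝ (fun W : PBond (F.P K) k → MatA 2 => avgM W c) (coeField Vk) (fun b => fluctMat F k K x b * ((Vk b : SU 2) : MatA 2))) 0 := by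
    have h := N07CentralDescendantLifts.hasDerivAt_coe_avgFun_comp_apply_of_small_of_local hk (Φ := fun s : ℝ => pert F k K Vk (s • x)) c
      (by rw [h0]; exact hsmall c) (Vdot := fun b => fluctMat F k K x b * ((Vk b : SU 2) : MatA 2)) fun b _ => hasDerivAt_coe_pert_line F k K Vk x b
    rw [h0] at h
    exact h
  have hG := havg.mul_const (star (((avgFun expMeanLogSU Vk c : SU 2) : MatA 2)))
  have hG0 : ((avgFun expMeanLogSU (pert F k K Vk ((0 : ℝ) • x)) c : SU 2) : MatA 2) * star (((avgFun expMeanLogSU Vk c : SU 2) : MatA 2)) = 1 := by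
    rw [h0]
    exact (Matrix.mem_unitaryGroup_iff).mp (Matrix.mem_specialUnitaryGroup_iff.mp (avgFun expMeanLogSU Vk c).2).1
  have hmlog : HasFDerivAt (MatrixLog.mlog : MatA 2 → MatA 2) ((1 : MatA 2 →L[ℂ] MatA 2).restrictScalars ℝ)
      ((fun s : ℝ => ((avgFun expMeanLogSU (pert F k K Vk (s • x)) c : SU 2) : MatA 2) * star (((avgFun expMeanLogSU Vk c : SU 2) : MatA 2))) 0) := by
    have e : (fun s : ℝ => ((avgFun expMeanLogSU (pert F k K Vk (s • x)) c : SU 2) : MatA 2) * star (((avgFun expMeanLogSU Vk c : SU 2) : MatA 2))) 0 = 1 := hG0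
    rw [e]
    exact (B7TransferAnalyticMean.hasFDerivAt_mlog_one (𝔄 := MatA 2)).restrictScalars ℝ
  have hR := hmlog.comp_hasDerivAt (0 : ℝ) hG
  have hfun : (fun s : ℝ => recordQt F k K Vk (s • x) c) = (MatrixLog.mlog : MatA 2 → MatA 2) ∘ fun s : ℝ =>
      ((avgFun expMeanLogSU (pert F k K Vk (s • x)) c : SU 2) : MatA 2) * star (((avgFun expMeanLogSU Vk c : SU 2) : MatA 2)) :=
    funext fun s => recordQt_apply_eq_mlog F k K Vk (s • x) c
  rw [hfun] at hL
  have heq := hL.unique hR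
  rw [heq]
  rfl

/-! ## §3  𝔰𝔲(2) coordinates (bookkeeping) -/

/-- A real combination of the basis `su2Gen` lies in 𝔰𝔲(2). [folklore] -/
theorem sum_smul_su2Gen_mem_lieSU (v : Fin 3 → ℝ) : (∑ a, ((v a : ℝ) : ℂ) • su2Gen a) ∈ lieSU (Fin 2) := by
  rw [mem_lieSU_iff]
  constructor
  · rw [star_sum, ← Finset.sum_neg_distrib]
    refine Finset.sum_congr rfl fun a _ => ?_
    rw [star_smul, star_su2Gen, Complex.star_def, Complex.conj_ofReal, smul_neg]
  · rw [Matrix.trace_sum]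
    exact Finset.sum_eq_zero fun a _ => by rw [Matrix.trace_smul, trace_su2Gen, smul_zero]

/-- `su2Coord` reads the coefficients of a real combination of `su2Gen`. [folklore] -/
theorem su2Coord_sum_smul_su2Gen (v : Fin 3 → ℝ) (j : Fin 3) : su2Coord (∑ a, ((v a : ℝ) : ℂ) • su2Gen a) j = v j := by
  fin_cases j <;> simp [su2Coord, su2Gen, Fin.sum_univ_three, Matrix.add_apply]

/-- **An 𝔰𝔲(2) matrix is the real combination of `su2Gen` with its `su2Coord` coefficients.** [folklore] -/
theorem sum_su2Coord_smul_su2Gen {X : MatA 2} (hX : X ∈ lieSU (Fin 2)) : (∑ a, ((su2Coord X a : ℝ) : ℂ) • su2Gen a) = X := by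
  have hmem : (∑ a, ((su2Coord X a : ℝ) : ℂ) • su2Gen a) - X ∈ lieSU (Fin 2) := Submodule.sub_mem _ (sum_smul_su2Gen_mem_lieSU _) hX
  have hsub : ∀ (M N : MatA 2) (j : Fin 3), su2Coord (M - N) j = su2Coord M j - su2Coord N j := fun M N j => by
    fin_cases j <;> simp [su2Coord]
  have h0 := eq_zero_of_mem_lieSU_of_su2Coord hmem fun j => by rw [hsub, su2Coord_sum_smul_su2Gen, sub_self]
  exact sub_eq_zero.mp h0

/-- The coordinate vector supported on one bond `β` with colour coefficients `v`: its 𝔰𝔲(2) matrix is `Σ_a v_a su2Gen a` at `β` and `0` elsewhere. [cite: Balaban1987RG1, (2.4) p.266 (bookkeeping)] -/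
theorem fluctMat_bondVec (k K : ℕ) (β : PBond (F.P K) k) (v : Fin 3 → ℝ) (b : PBond (F.P K) k) :
    fluctMat F k K (fun i : FluctIdx F k K => if i.1 = β then v i.2 else 0) b = if b = β then ∑ a, ((v a : ℝ) : ℂ) • su2Gen a else 0 := by
  by_cases hb : b = β
  · simp [fluctMat, hb]
  · simp [fluctMat, hb]

/-! ## §4  ★★★ The letter at every small background -/

open Classical in
/-- The `c`-block of `A₁ = recordLQtB0 Vk` applied to colour coefficients `v` is the `c`-row of the coordinate matrix of `LQ̃(Vk)` applied to the coordinate vector supported on `b₀(c)` with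
coefficients `v`. [cite: Balaban1987RG1, p.267 (bookkeeping)] -/
theorem b0Block_mulVec (k K : ℕ) (Vk : GaugeField (F.P K) k (SU 2)) (c : PBond (F.P K) (k + 1)) (v : Fin 3 → ℝ) (j : Fin 3) :
    (Matrix.of fun j j' : Fin 3 => recordLQtB0 F k K Vk (c, j) (c, j')).mulVec v j =
      su2Coord (recordLQt F k K Vk (fun i : FluctIdx F k K => if i.1 = recordB0 F k K c then v i.2 else 0) c) j := by
  have h := recordLQtMat_mulVec F k K Vk (fun i : FluctIdx F k K => if i.1 = recordB0 F k K c then v i.2 else 0) (c, j)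
  rw [← h]
  simp only [Matrix.mulVec, dotProduct, Matrix.of_apply, recordLQtB0]
  rw [Fintype.sum_prod_type, Finset.sum_eq_single (recordB0 F k K c)]
  · simp
  · intro b _ hb
    simp [hb]
  · intro h; exact absurd (Finset.mem_univ _) h

open Classical in
/-- ★★★ **THE LETTER `RecordB0BlockInvertible` AT EVERY SMALL BACKGROUND** (print's «h is uniquely defined», p.267, off the base point): in the standing range `k + 1 ≤ m + K`, if every
(0.4) loop variable of `V^{(k)}` at every coarse bond is within `α` of `1` with `α ≤ 1∕24` and `157·α < L^{1−d}`, then the `b₀`-block `A₁` of `LQ̃(V^{(k)})` is invertible.  Each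
`3 × 3` block `A₁(c)` is ONTO: by `…N07CentralResponseOnto.centralResponse_onto_sharp` the response of the (0.4) average in its private coordinate `b₀(c)` is onto the tangent space at
`Ū(c)`, and `LQ̃(Vk)` is that response times `Ū(c)*` (`recordLQt_apply_eq_fderiv_avgM`); onto square blocks are nonsingular, and `det A₁ = ∏_c det A₁(c)` (`det_recordLQtB0_eq_prod`).
[cite: Balaban1987RG1, p.267–268, (0.4) p.253; Balaban1985Averaging, Prop. 3 (124) p.36] -/
theorem recordB0BlockInvertible_of_loopSmall (k K : ℕ) (hk : k + 1 ≤ (F.P K).m + (F.P K).K) (Vk : GaugeField (F.P K) k (SU 2)) {α : ℝ}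
    (hα : ∀ (c : PBond (F.P K) (k + 1)) (i : Idx (F.P K)), dist1 (loopHol Vk c i) ≤ α) (hα24 : α ≤ 1 / 24)
    (hαL : 157 * α < (((F.P K).L : ℝ) ^ ((F.P K).d - 1))⁻¹) : RecordB0BlockInvertible F k K Vk := by
  have hαδ : α < deltaSU (Fin 2) := by
    -- `deltaSU (Fin 2) = min (1∕3) (π∕2) ≥ 1∕3 > 1∕24 ≥ α` (cf. `HistoryTailBoundedHeight.third_le_deltaSU_two`)
    have h3 : (1 : ℝ) / 3 ≤ deltaSU (Fin 2) := by
      rw [deltaSU, Fintype.card_fin]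
      refine le_min le_rfl ?_
      have := Real.pi_gt_three
      push_cast
      linarith
    linarith
  have hsmall : ∀ c : PBond (F.P K) (k + 1), Small expMeanLogSU Vk c := fun c i => lt_of_le_of_lt (hα c i) hαδ
  rw [RecordB0BlockInvertible, isUnit_iff_ne_zero, det_recordLQtB0_eq_prod F k K hk, Finset.prod_ne_zero_iff]
  intro c _
  suffices hsurj : Function.Surjective (Matrix.of fun j j' : Fin 3 => recordLQtB0 F k K Vk (c, j) (c, j')).mulVec by
    exact ((Matrix.isUnit_iff_isUnit_det _).mp (Matrix.mulVec_surjective_iff_isUnit.mp hsurj)).ne_zero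
  intro w
  -- names
  set β : PBond (F.P K) k := recordB0 F k K c with hβ
  set Ubar : MatA 2 := ((avgFun expMeanLogSU Vk c : SU 2) : MatA 2) with hUbar
  set uβ : MatA 2 := ((Vk β : SU 2) : MatA 2) with huβ
  set Mw : MatA 2 := ∑ j, ((w j : ℝ) : ℂ) • su2Gen j with hMw
  have hMw_mem : Mw ∈ lieSU (Fin 2) := sum_smul_su2Gen_mem_lieSU w
  have hUbar_mem : Ubar ∈ Matrix.unitaryGroup (Fin 2) ℂ := (Matrix.mem_specialUnitaryGroup_iff.mp (avgFun expMeanLogSU Vk c).2).1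
  have huβ_mem : uβ ∈ Matrix.unitaryGroup (Fin 2) ℂ := (Matrix.mem_specialUnitaryGroup_iff.mp (Vk β).2).1
  have hUU : Ubar * star Ubar = 1 := Matrix.mem_unitaryGroup_iff.mp hUbar_mem
  have hUU' : star Ubar * Ubar = 1 := Matrix.mem_unitaryGroup_iff'.mp hUbar_mem
  have huu' : star uβ * uβ = 1 := Matrix.mem_unitaryGroup_iff'.mp huβ_mem
  -- the target tangent vector at `Ū(c)`, pulled back to 𝔰𝔲(2): `Y′ = Ū* · M_w · Ū`
  have hY' : star Ubar * Mw * Ubar ∈ lieSU (Fin 2) := by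
    have h := conj_mem_lieSU hMw_mem ⟨star Ubar, Unitary.star_mem hUbar_mem⟩
    simpa only [star_star] using h
  -- the response is ONTO in the private coordinate `b₀(c)` (dag-n07-w2)
  obtain ⟨Y, hY⟩ := N07CentralResponseOnto.centralResponse_onto_sharp hk Vk c (hα c) hα24 hαδ hαL ⟨_, hY'⟩
  -- the direction: `X = u_β Y u_β*` on the bond `b₀(c)`, read in `su2Coord` coordinates
  set X : MatA 2 := uβ * (Y : MatA 2) * star uβ with hX
  have hX_mem : X ∈ lieSU (Fin 2) := conj_mem_lieSU Y.2 ⟨uβ, huβ_mem⟩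
  refine ⟨fun a => su2Coord X a, ?_⟩
  set e : FluctIdx F k K → ℝ := fun i => if i.1 = β then su2Coord X i.2 else 0 with he
  -- its bond velocities: `X·u_β = u_β·Y` at `b₀(c)`, `0` elsewhere
  have hvel : (fun b => fluctMat F k K e b * ((Vk b : SU 2) : MatA 2)) = Pi.single (centralBond c) (uβ * (Y : MatA 2)) := by
    funext b
    rw [he, fluctMat_bondVec F k K β (fun a => su2Coord X a) b, sum_su2Coord_smul_su2Gen hX_mem]
    by_cases hb : b = β
    · subst hb
      rw [if_pos rfl, hβ]
      show X * uβ = (Pi.single (centralBond c) (uβ * (Y : MatA 2)) : PBond (F.P K) k → MatA 2) (centralBond c)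
      rw [Pi.single_eq_same, hX, mul_assoc, huu', mul_one]
    · rw [if_neg hb, zero_mul]
      have hb' : b ≠ centralBond c := hb
      rw [Pi.single_eq_of_ne hb']
  -- hence `LQ̃(Vk) e (c) = M_w`
  have hLQt : recordLQt F k K Vk e c = Mw := by
    rw [recordLQt_apply_eq_fderiv_avgM F k K hk Vk hsmall e c, hvel]
    have hY1 : fderiv ℝ (fun W : PBond (F.P K) k → MatA 2 => avgM W c) (coeField Vk) (Pi.single (centralBond c) (uβ * (Y : MatA 2))) =
        Ubar * (star Ubar * Mw * Ubar) := hY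
    rw [hY1]
    calc Ubar * (star Ubar * Mw * Ubar) * star Ubar = (Ubar * star Ubar) * Mw * (Ubar * star Ubar) := by noncomm_ring
      _ = Mw := by rw [hUU, one_mul, mul_one]
  -- and the block times the coefficients is `w`
  funext j
  rw [b0Block_mulVec, ← he, hLQt, hMw, su2Coord_sum_smul_su2Gen]

/-- ★★★ **THE LETTER IN PLAQUETTE CURRENCY**: if every plaquette variable of `V^{(k)}` is within `t` of `1` (`PlaqSmall t Vk`, the small-field currency of the texts' token `TokE`), with
`((d+2)L)²t∕4 ≤ 1∕24` and `157·((d+2)L)²t∕4 < L^{1−d}`, then `RecordB0BlockInvertible F k K Vk` (loop variables are products of `≤ ((d+2)L)²∕4` plaquettes: `LatticeWordStokes.dist1_loopHol_le`).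
[cite: Balaban1987RG1, p.267–268, (0.4) p.253; Balaban1985Averaging, (19)–(20) p.21] -/
theorem recordB0BlockInvertible_of_plaqSmall (k K : ℕ) (hk : k + 1 ≤ (F.P K).m + (F.P K).K) (Vk : GaugeField (F.P K) k (SU 2)) {t : ℝ} (ht : 0 ≤ t)
    (hsm : PlaqSmall t Vk) (h24 : ((((F.P K).d + 2) * (F.P K).L : ℕ) : ℝ) ^ 2 / 4 * t ≤ 1 / 24)
    (hL : 157 * (((((F.P K).d + 2) * (F.P K).L : ℕ) : ℝ) ^ 2 / 4 * t) < (((F.P K).L : ℝ) ^ ((F.P K).d - 1))⁻¹) :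
    RecordB0BlockInvertible F k K Vk :=
  recordB0BlockInvertible_of_loopSmall F k K hk Vk (fun c i => LatticeWordStokes.dist1_loopHol_le ht hsm c i) h24 hL

end Summit.QuantumFields.YangMills.Theorems.BalabanUVNodesPortS1

end
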